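import Summits.CriticalPhenomena.SAWScalingLimit.Theorems.SAWWeldingIdentificationWeldingLawOfLimitNecessity

/-!
# Welding-stable chord proxies are necessary (crux `WeldingLawOfLimit`, stmt-4502)

Route `SAWWeldingIdentification` of `CriticalPhenomena/SAWScalingLimit`, crux (W)
`WeldingLawOfLimit` (stmt-CriticalPhenomena-4502), line `registered` = the strategist's skeleton
`Cruxes/WeldingLawOfLimit/Lines/stable_proxies.lean` (lead c12). That skeleton cuts the leaf
`LatticeWeldingLaw` into

* Stub A `StableChordProxies` — chord proxies `cₙ ω` of the critical `ℤ²` SAW exist (functions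
  of the walk, eventually a.s. simple chords of `(Ω; a, b) = Q.chord 0 2`, close to the walk in
  probability) whose canonical welding is STABLE in probability, uniformly in the mesh: for every
  `x > 0`, `ε > 0`, `η > 0` there is `ρ > 0` with, eventually in `n`,
  `P_δₙ {ω | ∃ simple chord γ', dist γ' (cₙ ω) < ρ ∧ ε ≤ |h γ' x - h (cₙ ω) x|} ≤ η`
  (`h = conformalWelding Q`); and
* Stub B `WeldingLawOfStableProxies` — every stable family carries the SLE_{8/3} welding law.

This file is the SOUNDNESS CERTIFICATE of Stub A: it follows from the route's own cruxes
stmt-1372 (`EventualTight`) and stmt-4982 (`SimpleSubseqLimits`), hence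
(`stableChordProxies_of_sawScalingLimit`) from the conjunct `SAWScalingLimit` unconditionally —
so the new cut asks nothing the Lawler–Schramm–Werner conjecture (as typed) does not already give.

## Proof

`exists_subseq_tendsto_integral_curve` is the subsequence principle behind
`tendsto_measure_curve_mem_of_isClosed` with the limit exposed (Prokhorov along the mesh on
surrogate probability laws; stmt-4982 on the limit). `exists_eventually_measure_curve_mem_le_of_antitone`
is a UNIFORM portmanteau bound: decreasing closed sets `F j` with chord-free intersection get SAW
mass `≤ η` for some `j`, eventually (else a diagonal subsequence and the closed-set portmanteau
inequality give a chord-supported limit `P'` with `P' (F j) ≥ η` for all `j`, while `P' (⋂ F j) = 0`).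
The necessity theorem applies it to `F j = cthickening (1/(j+1)) (S ∩ B (1/(j+1)))`, `S` the simple
chords, `B ρ = {γ | ∃ γ' ∈ S, dist γ' γ < ρ ∧ ε ≤ |h γ' - h γ|}`: these decrease, and their
intersection misses `S` by continuity of `h` ON `S` (`continuousOn_conformalWelding`).

References: Billingsley, *Convergence of Probability Measures* (1999), Thms 2.1, 5.1;
Pommerenke, *Boundary Behaviour of Conformal Maps* (1992), Thm 2.11. No new definition or fact.
-/

noncomputable section

open MeasureTheory Filter Topology Set
open scoped NNReal ENNReal BoundedContinuousFunction
open Literature.Probability.RandomPlanarGeometry Literature.Probability.LatticeModels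
open Summit.CriticalPhenomena.SAWScalingLimit.Theses

namespace Summit.CriticalPhenomena.SAWScalingLimit.Theorems.WeldingLawOfLimit

/-! ### Subsequential weak limits, exposed -/

/-- **Subsequence principle with the limit exposed.** Under `EventualTight` (stmt-1372) and
`SimpleSubseqLimits` (stmt-4982): for every conformal rectangle `Q`, endpoint approximation of
`(Ω; a, b) = Q.chord 0 2`, positive `δₙ → 0` and every `ns : ℕ → ℕ` tending to infinity there are
a strictly increasing `ψ` and a probability measure `P'` on curve classes, carried by the simple
chords of `(Ω; a, b)`, such that the SAW laws at the meshes `δ_{ns (ψ m)}` are probability measures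
and their push-forwards under `ω ↦ ω.curve` converge weakly to `P'`. Prokhorov along the mesh
(`IsTightAlongMesh.exists_subseq`, applied to surrogate probability laws that agree with the
pushed-forward SAW laws for all small `δ`), then stmt-4982 identifies the carrier of the limit.
Billingsley (1999) Thm 5.1. [folklore] -/
theorem exists_subseq_tendsto_integral_curve (hT : SAWWeldingIdentification.EventualTight)
    (h1 : SAWLoopFugacityFlow.SimpleSubseqLimits) (Q : ConformalRectangle) (a b : ℝ → Site 2)
    (hab : SAW.IsEndpointApprox (Q.chord 0 2 (by decide)) a b)
    (δs : ℕ → ℝ) (hpos : ∀ n, 0 < δs n) (hδ : Tendsto δs atTop (𝓝 0))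
    (ns : ℕ → ℕ) (hns : Tendsto ns atTop atTop) :
    ∃ (ψ : ℕ → ℕ) (P' : Measure (CurveClass ℂ)), StrictMono ψ ∧ IsProbabilityMeasure P' ∧
      (∀ m, IsProbabilityMeasure
        (SAW.law Q.carrier (δs (ns (ψ m))) (a (δs (ns (ψ m)))) (b (δs (ns (ψ m)))))) ∧
      (∀ᵐ γ ∂P', (Q.chord 0 2 (by decide)).IsSimpleChord γ) ∧
      ∀ g : CurveClass ℂ →ᵇ ℝ,
        Tendsto (fun m => ∫ ω, g ω.curve
          ∂(SAW.law Q.carrier (δs (ns (ψ m))) (a (δs (ns (ψ m)))) (b (δs (ns (ψ m))))))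
          atTop (𝓝 (∫ γ, g γ ∂P')) := by
  classical
  have hYm : ∀ δ, AEMeasurable (fun γ : SAW.DomainSAW Q.carrier δ (a δ) (b δ) => γ.curve)
      (SAW.law Q.carrier δ (a δ) (b δ)) := fun δ => SAW.aemeasurable_curve _ _ _ _
  have hP : ∀ᶠ δ in 𝓝[>] (0 : ℝ), IsProbabilityMeasure (SAW.law Q.carrier δ (a δ) (b δ)) :=
    (SubseqIdentification.Negative.eventually_isProbabilityMeasure_law hab).mono
      fun δ h => ⟨h.measure_univ⟩
  -- (1) surrogate family of probability laws on the curve space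
  obtain ⟨ν, hν⟩ : ∃ ν : ℝ → Measure (CurveClass ℂ), ∀ δ, ν δ =
      if IsProbabilityMeasure ((SAW.law Q.carrier δ (a δ) (b δ)).map fun γ => γ.curve) then
        (SAW.law Q.carrier δ (a δ) (b δ)).map fun γ => γ.curve
      else Measure.dirac (CurveClass.mk (Curve.const 0)) :=
    ⟨_, fun _ => rfl⟩
  haveI hνprob : ∀ δ, IsProbabilityMeasure (ν δ) := by
    intro δ
    by_cases h : IsProbabilityMeasure ((SAW.law Q.carrier δ (a δ) (b δ)).map fun γ => γ.curve)
    · rw [hν δ, if_pos h]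
      exact h
    · rw [hν δ, if_neg h]
      infer_instance
  -- (2) for all small `δ > 0` the law is a probability measure and the surrogate IS its image
  have hev : ∀ᶠ δ in 𝓝[>] (0 : ℝ), IsProbabilityMeasure (SAW.law Q.carrier δ (a δ) (b δ)) ∧
      ν δ = (SAW.law Q.carrier δ (a δ) (b δ)).map fun γ => γ.curve := by
    filter_upwards [hP] with δ hPδ
    haveI := hPδ
    exact ⟨hPδ, by rw [hν δ, if_pos (Measure.isProbabilityMeasure_map (hYm δ))]⟩
  -- (3) tightness along the mesh, for the laws and for the surrogates
  obtain ⟨δ₀, hδ₀, hTset⟩ := hT (Q.chord 0 2 (by decide)) a b hab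
  have hTm : IsTightAlongMesh (fun δ (γ : SAW.DomainSAW Q.carrier δ (a δ) (b δ)) => γ.curve)
      (fun δ => SAW.law Q.carrier δ (a δ) (b δ)) :=
    isTightAlongMesh_of_isTightMeasureSet_image (Eventually.of_forall hYm) hδ₀ hTset
  have hTν : IsTightAlongMesh (Ωδ := fun _ : ℝ => CurveClass ℂ)
      (fun (_ : ℝ) (x : CurveClass ℂ) => x) ν := by
    intro ε hε
    obtain ⟨K, hK, hb⟩ := hTm ε hε
    refine ⟨K, hK, ?_⟩
    filter_upwards [hb, hev] with δ hδK hδν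
    have hpre : (fun x : CurveClass ℂ => x) ⁻¹' Kᶜ = Kᶜ := rfl
    rw [hpre, hδν.2,
      Measure.map_apply_of_aemeasurable (hYm δ) hK.isClosed.isOpen_compl.measurableSet]
    exact hδK
  -- (4) along `ns`, shifted past the index from which the surrogate is the law
  have hs : Tendsto (fun m => δs (ns m)) atTop (𝓝[>] (0 : ℝ)) :=
    (tendsto_nhdsWithin_Ioi_of_pos hpos hδ).comp hns
  obtain ⟨N, hN⟩ := eventually_atTop.1 (hs.eventually hev)
  have hs' : Tendsto (fun m => δs (ns (m + N))) atTop (𝓝[>] (0 : ℝ)) :=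
    hs.comp (tendsto_add_atTop_nat N)
  have hN' : ∀ m, ν (δs (ns (m + N))) =
      (SAW.law Q.carrier (δs (ns (m + N))) (a (δs (ns (m + N)))) (b (δs (ns (m + N))))).map
        fun γ => γ.curve := fun m => (hN _ (N.le_add_left m)).2
  -- Prokhorov for the surrogates along the shifted subsequence
  obtain ⟨φ, P', hφ, hP', hlim⟩ := hTν.exists_subseq
    (Eventually.of_forall fun _ => aemeasurable_id') hs'
  haveI := hP'
  have hint : ∀ (g : CurveClass ℂ →ᵇ ℝ) (m : ℕ), ∫ x, g x ∂ν (δs (ns (φ m + N))) =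
      ∫ ω, g ω.curve ∂(SAW.law Q.carrier (δs (ns (φ m + N))) (a (δs (ns (φ m + N))))
        (b (δs (ns (φ m + N))))) := fun g m => by
    rw [hN' (φ m), integral_map (hYm _) g.continuous.aestronglyMeasurable]
  have hconv : ∀ g : CurveClass ℂ →ᵇ ℝ,
      Tendsto (fun m => ∫ ω, g ω.curve ∂(SAW.law Q.carrier (δs (ns (φ m + N)))
        (a (δs (ns (φ m + N)))) (b (δs (ns (φ m + N)))))) atTop (𝓝 (∫ γ, g γ ∂P')) := by
    intro g
    have h := hlim g
    simp only [hint g] at h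
    exact h
  -- the subsequential limit is chord-supported (stmt-4982)
  have hP'S : ∀ᵐ γ ∂P', (Q.chord 0 2 (by decide)).IsSimpleChord γ :=
    h1 (Q.chord 0 2 (by decide)) a b hab (fun m => δs (ns (φ m + N))) P'
      (hs'.comp hφ.tendsto_atTop) hP' hconv
  exact ⟨fun m => φ m + N, P', fun m m' h => Nat.add_lt_add_right (hφ h) N, hP',
    fun m => (hN _ (N.le_add_left (φ m))).1, hP'S, hconv⟩

/-! ### A uniform portmanteau bound over decreasing closed sets -/

/-- **Decreasing closed sets whose intersection contains no simple chord get uniformly small SAW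
mass.** Assume `EventualTight` (stmt-1372) and `SimpleSubseqLimits` (stmt-4982). Let `F j` be a
decreasing sequence of closed sets of curve classes such that every simple chord of
`(Ω; a, b) = Q.chord 0 2` lies outside some `F j`. Then for every `η > 0` there is `j` with
`P_δₙ {ω.curve ∈ F j} ≤ η` eventually in `n`. Otherwise a diagonal subsequence `n_k` has
`P_{δ_{n_k}} (F k) > η`; by `exists_subseq_tendsto_integral_curve` a further subsequence
converges weakly to a chord-supported probability measure `P'`, and the closed-set portmanteau
inequality (`ProbabilityMeasure.limsup_measure_closed_le_of_tendsto`) gives `P' (F j) ≥ η` for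
every `j`, contradicting `P' (⋂ F j) = 0` (continuity from above; the intersection is chord-free).
Billingsley (1999) Thms 2.1, 5.1. [folklore] -/
theorem exists_eventually_measure_curve_mem_le_of_antitone
    (hT : SAWWeldingIdentification.EventualTight) (h1 : SAWLoopFugacityFlow.SimpleSubseqLimits)
    (Q : ConformalRectangle) (a b : ℝ → Site 2)
    (hab : SAW.IsEndpointApprox (Q.chord 0 2 (by decide)) a b)
    (δs : ℕ → ℝ) (hpos : ∀ n, 0 < δs n) (hδ : Tendsto δs atTop (𝓝 0))
    {F : ℕ → Set (CurveClass ℂ)} (hFc : ∀ j, IsClosed (F j)) (hanti : Antitone F)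
    (hF : ∀ γ, (Q.chord 0 2 (by decide)).IsSimpleChord γ → ∃ j, γ ∉ F j)
    {η : ℝ≥0∞} (hη : 0 < η) :
    ∃ j, ∀ᶠ n in atTop,
      SAW.law Q.carrier (δs n) (a (δs n)) (b (δs n)) {ω | ω.curve ∈ F j} ≤ η := by
  classical
  have hYm : ∀ δ, AEMeasurable (fun γ : SAW.DomainSAW Q.carrier δ (a δ) (b δ) => γ.curve)
      (SAW.law Q.carrier δ (a δ) (b δ)) := fun δ => SAW.aemeasurable_curve _ _ _ _
  by_contra hcon
  have hfreq : ∀ j, ∃ᶠ n in atTop,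
      η < SAW.law Q.carrier (δs n) (a (δs n)) (b (δs n)) {ω | ω.curve ∈ F j} := by
    intro j
    by_contra h
    refine hcon ⟨j, ?_⟩
    simpa only [not_frequently, not_lt] using h
  -- diagonal subsequence `ns k` with `η < P_{δ (ns k)} (F k)`
  have hex : ∀ j M : ℕ, ∃ n, M ≤ n ∧
      η < SAW.law Q.carrier (δs n) (a (δs n)) (b (δs n)) {ω | ω.curve ∈ F j} :=
    fun j M => frequently_atTop.1 (hfreq j) M
  choose g hg_ge hg_lt using hex
  obtain ⟨ns, hns_mono, hns_prop⟩ : ∃ ns : ℕ → ℕ, StrictMono ns ∧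
      ∀ k, η < SAW.law Q.carrier (δs (ns k)) (a (δs (ns k))) (b (δs (ns k)))
        {ω | ω.curve ∈ F k} := by
    let ns : ℕ → ℕ := fun k => Nat.rec (g 0 0) (fun k nk => g (k + 1) (nk + 1)) k
    have hsucc : ∀ k, ns (k + 1) = g (k + 1) (ns k + 1) := fun k => rfl
    have h0 : ns 0 = g 0 0 := rfl
    refine ⟨ns, strictMono_nat_of_lt_succ fun k => ?_, fun k => ?_⟩
    · rw [hsucc]
      exact Nat.lt_of_lt_of_le (Nat.lt_succ_self _) (hg_ge _ _)
    · cases k with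
      | zero => rw [h0]; exact hg_lt 0 0
      | succ k => rw [hsucc]; exact hg_lt _ _
  -- a further subsequence converging weakly to a chord-supported probability measure
  obtain ⟨ψ, P', hψ, hP', hprob, hchord, hconv⟩ :=
    exists_subseq_tendsto_integral_curve hT h1 Q a b hab δs hpos hδ ns hns_mono.tendsto_atTop
  haveI := hP'
  -- the image laws, as probability measures, converge to `P'`
  let μs : ℕ → ProbabilityMeasure (CurveClass ℂ) := fun m =>
    ⟨(SAW.law Q.carrier (δs (ns (ψ m))) (a (δs (ns (ψ m)))) (b (δs (ns (ψ m))))).map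
      fun γ => γ.curve, by
        haveI := hprob m
        exact Measure.isProbabilityMeasure_map (hYm _)⟩
  let Q' : ProbabilityMeasure (CurveClass ℂ) := ⟨P', hP'⟩
  have hμs : Tendsto μs atTop (𝓝 Q') := by
    refine ProbabilityMeasure.tendsto_iff_forall_integral_tendsto.2 fun f => ?_
    have e : ∀ m, ∫ x, f x ∂(μs m : Measure (CurveClass ℂ)) =
        ∫ ω, f ω.curve ∂(SAW.law Q.carrier (δs (ns (ψ m))) (a (δs (ns (ψ m))))
          (b (δs (ns (ψ m))))) := fun m =>
      integral_map (hYm _) f.continuous.aestronglyMeasurable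
    simp only [e]
    exact hconv f
  -- portmanteau: `P' (F j) ≥ η` for every `j`
  have hPj : ∀ j, η ≤ P' (F j) := by
    intro j
    have hls := ProbabilityMeasure.limsup_measure_closed_le_of_tendsto hμs (hFc j)
    refine le_trans (le_limsup_of_frequently_le' (Eventually.frequently ?_)) hls
    refine (eventually_ge_atTop j).mono fun m hm => ?_
    have hk : j ≤ ψ m := hm.trans hψ.le_apply
    calc η ≤ SAW.law Q.carrier (δs (ns (ψ m))) (a (δs (ns (ψ m)))) (b (δs (ns (ψ m))))
          {ω | ω.curve ∈ F (ψ m)} := (hns_prop (ψ m)).le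
      _ ≤ SAW.law Q.carrier (δs (ns (ψ m))) (a (δs (ns (ψ m)))) (b (δs (ns (ψ m))))
          {ω | ω.curve ∈ F j} := measure_mono fun ω hω => hanti hk hω
      _ = (μs m : Measure (CurveClass ℂ)) (F j) := by
          rw [show (μs m : Measure (CurveClass ℂ)) =
              (SAW.law Q.carrier (δs (ns (ψ m))) (a (δs (ns (ψ m)))) (b (δs (ns (ψ m))))).map
                fun γ => γ.curve from rfl,
            Measure.map_apply_of_aemeasurable (hYm _) (hFc j).measurableSet]
          rfl
  -- continuity from above: `P' (⋂ F j) ≥ η > 0`, but the intersection is chord-free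
  have hlimF : Tendsto (fun j => P' (F j)) atTop (𝓝 (P' (⋂ j, F j))) :=
    tendsto_measure_iInter_atTop (fun j => (hFc j).measurableSet.nullMeasurableSet) hanti
      ⟨0, measure_ne_top _ _⟩
  have hge : η ≤ P' (⋂ j, F j) := ge_of_tendsto' hlimF hPj
  have hzero : P' (⋂ j, F j) = 0 := by
    have hsub : (⋂ j, F j) ⊆ {γ | ¬ (Q.chord 0 2 (by decide)).IsSimpleChord γ} := by
      intro γ hγ hγS
      obtain ⟨j, hj⟩ := hF γ hγS
      exact hj (mem_iInter.1 hγ j)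
    exact measure_mono_null hsub (ae_iff.1 hchord)
  rw [hzero] at hge
  exact (not_lt.2 hge) hη

/-! ### Stub A is necessary -/

/-- The critical SAW law is a finite measure (a probability measure or zero). [folklore] -/
theorem isFiniteMeasure_sawLaw (Ω : Set ℂ) (δ : ℝ) (u v : Site 2) :
    IsFiniteMeasure (SAW.law Ω δ u v) := by
  rcases SubseqIdentification.Negative.isProbabilityMeasure_law_or_eq_zero Ω δ u v with h | h
  · infer_instance
  · rw [h]; infer_instance

/-- **Stub A `StableChordProxies` of line `stable_proxies` follows from stmt-1372 ∧ stmt-4982**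
(signature verbatim, the skeleton's `IsChordProxy ∧ IsWeldingStable` unfolded). Take the chord
proxies `cₙ` of `chordProxies_of_eventualTight_of_simpleSubseqLimits`. Fix `x, ε, η > 0`, let `S`
be the simple chords of `(Ω; a, b)`, `h = conformalWelding Q · x`, and for `ρ > 0` let
`B ρ = {γ | ∃ γ' ∈ S, dist γ' γ < ρ ∧ ε ≤ |h γ' - h γ|}`. The closed sets
`F j = cthickening (1/(j+1)) (S ∩ B (1/(j+1)))` decrease in `j`, and a simple chord `γ` lies in no
`F j` with `3/(j+1) < r₀`, where `r₀` is a continuity radius of `h` ON `S` at `γ` for `ε/2`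
(`continuousOn_conformalWelding`): a point `γ₂ ∈ S ∩ B (1/(j+1))` within `2/(j+1)` of `γ` and its
witness `γ₁ ∈ S` would both have `h`-values within `ε/2` of `h γ`. So
`exists_eventually_measure_curve_mem_le_of_antitone` gives `j` with `P_δₙ {ω.curve ∈ F j} ≤ η/2`
eventually; with `ρ = 1/(j+1)` the stability event lies in
`{cₙ ω ∉ S} ∪ {ρ < dist ω.curve (cₙ ω)} ∪ {ω.curve ∈ F j}` (if `cₙ ω ∈ S ∩ B ρ` is within `ρ` of
the walk then the walk is in the closed `ρ`-thickening), whose masses are eventually `0`, `< η/2`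
and `≤ η/2`. [folklore] -/
theorem stableChordProxies_of_eventualTight_of_simpleSubseqLimits :
    SAWWeldingIdentification.EventualTight → SAWLoopFugacityFlow.SimpleSubseqLimits →
    ∀ (Q : ConformalRectangle) (a b : ℝ → Site 2),
      SAW.IsEndpointApprox (Q.chord 0 2 (by decide)) a b →
      ∀ (δs : ℕ → ℝ), (∀ n, 0 < δs n) → Tendsto δs atTop (𝓝 0) →
      ∃ c : (n : ℕ) → SAW.DomainSAW Q.carrier (δs n) (a (δs n)) (b (δs n)) → CurveClass ℂ,
        ((∀ᶠ n in atTop, ∀ᵐ ω ∂(SAW.law Q.carrier (δs n) (a (δs n)) (b (δs n))),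
            (Q.chord 0 2 (by decide)).IsSimpleChord (c n ω)) ∧
         (∀ ε : ℝ, 0 < ε →
            Tendsto (fun n => (SAW.law Q.carrier (δs n) (a (δs n)) (b (δs n))).real
              {ω | ε < dist ω.curve (c n ω)}) atTop (𝓝 0))) ∧
        (∀ x : ℝ, 0 < x → ∀ ε : ℝ, 0 < ε → ∀ η : ℝ, 0 < η → ∃ ρ : ℝ, 0 < ρ ∧
          ∀ᶠ n in atTop, (SAW.law Q.carrier (δs n) (a (δs n)) (b (δs n))).real
            {ω | ∃ γ' : CurveClass ℂ, (Q.chord 0 2 (by decide)).IsSimpleChord γ' ∧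
              dist γ' (c n ω) < ρ ∧
              ε ≤ |conformalWelding Q γ' x - conformalWelding Q (c n ω) x|} ≤ η) := by
  intro hT h1 Q a b hab δs hpos hδ
  obtain ⟨c, hc1, hc2⟩ :=
    chordProxies_of_eventualTight_of_simpleSubseqLimits hT h1 Q a b hab δs hpos hδ
  refine ⟨c, ⟨hc1, hc2⟩, ?_⟩
  intro x _hx ε hε η hη
  -- the simple chords and the bad sets
  set S : Set (CurveClass ℂ) := {γ | (Q.chord 0 2 (by decide)).IsSimpleChord γ} with hSdef
  set B : ℝ → Set (CurveClass ℂ) := fun ρ =>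
    {γ | ∃ γ' ∈ S, dist γ' γ < ρ ∧
      ε ≤ |conformalWelding Q γ' x - conformalWelding Q γ x|} with hBdef
  have hBmono : ∀ {ρ ρ' : ℝ}, ρ ≤ ρ' → B ρ ⊆ B ρ' :=
    fun hρ γ ⟨γ', hγ'S, hd, hle⟩ => ⟨γ', hγ'S, hd.trans_le hρ, hle⟩
  -- radii `r j = 1/(j+1)` and the closed sets `F j`
  set r : ℕ → ℝ := fun j => 1 / ((j : ℝ) + 1) with hrdef
  have hrpos : ∀ j, 0 < r j := fun j => Nat.one_div_pos_of_nat
  have hranti : ∀ {i j : ℕ}, i ≤ j → r j ≤ r i := fun hij => Nat.one_div_le_one_div hij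
  set F : ℕ → Set (CurveClass ℂ) := fun j => Metric.cthickening (r j) (S ∩ B (r j)) with hFdef
  have hFc : ∀ j, IsClosed (F j) := fun j => Metric.isClosed_cthickening
  have hanti : Antitone F := fun i j hij =>
    (Metric.cthickening_mono (hranti hij) _).trans
      (Metric.cthickening_subset_of_subset _ (inter_subset_inter_right _ (hBmono (hranti hij))))
  -- every simple chord escapes some `F j` (continuity of the welding ON the simple chords)
  have hF : ∀ γ, (Q.chord 0 2 (by decide)).IsSimpleChord γ → ∃ j, γ ∉ F j := by
    intro γ hγ
    have hcont := (continuousOn_conformalWelding Q x) γ hγ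
    rw [Metric.continuousWithinAt_iff] at hcont
    obtain ⟨r₀, hr₀, hr₀ε⟩ := hcont (ε / 2) (half_pos hε)
    obtain ⟨j, hj⟩ := exists_nat_one_div_lt (show 0 < r₀ / 3 by positivity)
    have hrj : r j < r₀ / 3 := hj
    refine ⟨j, fun hγF => ?_⟩
    have hγF' : γ ∈ Metric.thickening (2 * r j) (S ∩ B (r j)) :=
      Metric.cthickening_subset_thickening' (by linarith [hrpos j]) (by linarith [hrpos j]) _ hγF
    obtain ⟨γ₂, ⟨hγ₂S, γ₁, hγ₁S, hd₁₂, hle⟩, hd₂⟩ := Metric.mem_thickening_iff.1 hγF'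
    -- `hd₂ : dist γ γ₂ < 2 r j`, `hd₁₂ : dist γ₁ γ₂ < r j`
    have h₂ : dist (conformalWelding Q γ₂ x) (conformalWelding Q γ x) < ε / 2 :=
      hr₀ε hγ₂S (by rw [dist_comm]; linarith)
    have h₁ : dist (conformalWelding Q γ₁ x) (conformalWelding Q γ x) < ε / 2 := by
      refine hr₀ε hγ₁S ?_
      calc dist γ₁ γ ≤ dist γ₁ γ₂ + dist γ₂ γ := dist_triangle _ _ _
        _ < r j + 2 * r j := by rw [dist_comm γ₂ γ]; exact add_lt_add hd₁₂ hd₂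
        _ < r₀ := by linarith
    rw [Real.dist_eq] at h₁ h₂
    have hlt : |conformalWelding Q γ₁ x - conformalWelding Q γ₂ x| < ε :=
      calc |conformalWelding Q γ₁ x - conformalWelding Q γ₂ x|
          ≤ |conformalWelding Q γ₁ x - conformalWelding Q γ x| +
            |conformalWelding Q γ x - conformalWelding Q γ₂ x| := abs_sub_le _ _ _
        _ < ε / 2 + ε / 2 := add_lt_add h₁ (by rwa [abs_sub_comm])
        _ = ε := add_halves ε
    exact (not_lt.2 hle) hlt
  -- the uniform portmanteau bound with `η/2`
  have hη2 : (0 : ℝ≥0∞) < ENNReal.ofReal (η / 2) := ENNReal.ofReal_pos.2 (half_pos hη)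
  obtain ⟨j, hj⟩ := exists_eventually_measure_curve_mem_le_of_antitone hT h1 Q a b hab δs hpos hδ
    hFc hanti hF hη2
  refine ⟨r j, hrpos j, ?_⟩
  have hD := hc2 (r j) (hrpos j)
  rw [Metric.tendsto_nhds] at hD
  filter_upwards [hj, hD (η / 2) (half_pos hη), hc1] with n hjn hDn hc1n
  set μ : Measure (SAW.DomainSAW Q.carrier (δs n) (a (δs n)) (b (δs n))) :=
    SAW.law Q.carrier (δs n) (a (δs n)) (b (δs n)) with hμ
  haveI : IsFiniteMeasure μ := isFiniteMeasure_sawLaw _ _ _ _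
  -- the covering events
  set E := {ω : SAW.DomainSAW Q.carrier (δs n) (a (δs n)) (b (δs n)) |
      ∃ γ' : CurveClass ℂ, (Q.chord 0 2 (by decide)).IsSimpleChord γ' ∧ dist γ' (c n ω) < r j ∧
        ε ≤ |conformalWelding Q γ' x - conformalWelding Q (c n ω) x|} with hE
  set N := {ω : SAW.DomainSAW Q.carrier (δs n) (a (δs n)) (b (δs n)) |
      ¬ (Q.chord 0 2 (by decide)).IsSimpleChord (c n ω)} with hN
  set D := {ω : SAW.DomainSAW Q.carrier (δs n) (a (δs n)) (b (δs n)) |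
      r j < dist ω.curve (c n ω)} with hDset
  set W := {ω : SAW.DomainSAW Q.carrier (δs n) (a (δs n)) (b (δs n)) | ω.curve ∈ F j} with hW
  have hsub : E ⊆ (N ∪ D) ∪ W := by
    intro ω hω
    by_cases hS : (Q.chord 0 2 (by decide)).IsSimpleChord (c n ω)
    · by_cases hd : r j < dist ω.curve (c n ω)
      · exact Or.inl (Or.inr hd)
      · refine Or.inr ?_
        obtain ⟨γ', hγ'S, hdγ', hle⟩ := hω
        have hB : c n ω ∈ S ∩ B (r j) := ⟨hS, γ', hγ'S, hdγ', hle⟩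
        exact Metric.mem_cthickening_of_dist_le _ _ _ _ hB (not_lt.1 hd)
    · exact Or.inl (Or.inl hS)
  have hN0 : μ.real N = 0 := by
    rw [measureReal_def, show μ N = 0 from ae_iff.1 hc1n, ENNReal.toReal_zero]
  have hD' : μ.real D < η / 2 := by
    have := hDn
    rwa [Real.dist_eq, sub_zero, abs_of_nonneg measureReal_nonneg] at this
  have hW' : μ.real W ≤ η / 2 := by
    rw [measureReal_def]
    exact ENNReal.toReal_le_of_le_ofReal (half_pos hη).le hjn
  have hmono : μ.real E ≤ μ.real ((N ∪ D) ∪ W) := measureReal_mono hsub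
  have hu1 : μ.real ((N ∪ D) ∪ W) ≤ μ.real (N ∪ D) + μ.real W := measureReal_union_le _ _
  have hu2 : μ.real (N ∪ D) ≤ μ.real N + μ.real D := measureReal_union_le _ _
  show μ.real E ≤ η
  linarith

/-- **Stub A follows from the conjunct `SAWScalingLimit`, unconditionally** (stmt-1372 and
stmt-4982 are themselves consequences of the conjunct: `eventualTight_of_sawScalingLimit`,
`simpleSubseqLimits_of_sawScalingLimit`). So a `stub-false` on `stub_stableChordProxies` would
refute the Lawler–Schramm–Werner conjecture as typed, not merely the line. [folklore] -/
theorem stableChordProxies_of_sawScalingLimit (hS : _root_.SAWScalingLimit) :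
    ∀ (Q : ConformalRectangle) (a b : ℝ → Site 2),
      SAW.IsEndpointApprox (Q.chord 0 2 (by decide)) a b →
      ∀ (δs : ℕ → ℝ), (∀ n, 0 < δs n) → Tendsto δs atTop (𝓝 0) →
      ∃ c : (n : ℕ) → SAW.DomainSAW Q.carrier (δs n) (a (δs n)) (b (δs n)) → CurveClass ℂ,
        ((∀ᶠ n in atTop, ∀ᵐ ω ∂(SAW.law Q.carrier (δs n) (a (δs n)) (b (δs n))),
            (Q.chord 0 2 (by decide)).IsSimpleChord (c n ω)) ∧
         (∀ ε : ℝ, 0 < ε →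
            Tendsto (fun n => (SAW.law Q.carrier (δs n) (a (δs n)) (b (δs n))).real
              {ω | ε < dist ω.curve (c n ω)}) atTop (𝓝 0))) ∧
        (∀ x : ℝ, 0 < x → ∀ ε : ℝ, 0 < ε → ∀ η : ℝ, 0 < η → ∃ ρ : ℝ, 0 < ρ ∧
          ∀ᶠ n in atTop, (SAW.law Q.carrier (δs n) (a (δs n)) (b (δs n))).real
            {ω | ∃ γ' : CurveClass ℂ, (Q.chord 0 2 (by decide)).IsSimpleChord γ' ∧
              dist γ' (c n ω) < ρ ∧
              ε ≤ |conformalWelding Q γ' x - conformalWelding Q (c n ω) x|} ≤ η) :=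
  stableChordProxies_of_eventualTight_of_simpleSubseqLimits (eventualTight_of_sawScalingLimit hS)
    (simpleSubseqLimits_of_sawScalingLimit hS)

end Summit.CriticalPhenomena.SAWScalingLimit.Theorems.WeldingLawOfLimit

end
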